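import Summits.Ventures.LatticeQCDFlow.Scaling.HubAcceptanceLaw
import Summits.Ventures.LatticeQCDFlow.Scaling.FlowSwapAcceptanceTwoSided

/-!
HONEST FRAMING: exact (Metropolis-corrected) sampling algorithms for lattice gauge theory; figures
of merit are autocorrelation/cost numbers at stated couplings and volumes; no continuum-physics
claim.

# TransportDefectCeiling — THE MAPS' TRANSPORT DEFECTS AT A COLD REPLICA CAP ITS RATE: EVERY ENTRY `r = (i,l)` WITH MAP
# `φ_r` HAS STATIONARY ACCEPTANCE `α_r ≤ 1 − ½Σ_u|μ_i(u) − μ_l(φ_r u)|`, SO AN IDLE REPLICA `k` HAS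
# `Gap ≤ t·Σ_{r∋k}(1 − TV_r)/(2m·μ_k(A)μ_k(Aᶜ))`; ON A HUB ENTRY THE ACCEPTANCE IS PINNED `p ≤ α ≤ 1 − TV`
# (lean-2 GEN-23, ours)

Venture-side (OURS).  Cell `lqcd-flow` (pub-lqcd), unit `pub-lqcd-lean-2-g23`, 2026-08-26.  Chapter K, file 15:
`Scaling/HubAcceptanceLaw` (K9: `α_r = Σ_x min{π̃(x),π̃(x^{(r)})}` is the two-level sum; `Gap ≤ t·Σ_{r∋k}α_r/(2m·Var_k)`)
combined with `Scaling/FlowSwapAcceptanceTwoSided` (F6: the two-level sum is `≤ 1 − ½Σ_u|μ_a(u) − μ_b(φu)|`, one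
minus the total variation between a level's law and the pull-back of its partner's).  `TV_r := ½Σ_u|μ_{i_r}(u) −
μ_{l_r}(φ_r u)|` is the TRANSPORT DEFECT of entry `r` — the quantity a trained flow between two couplings is judged by.

## What is proved

* **`edgeAcceptance_le_one_sub_tv`** — `α_r ≤ 1 − TV_r` for every entry with distinct endpoints.
* **`transportDefect_spectralGap_le`** — replica `k` idle (`w_k·Q_k(A,Aᶜ) = 0`), `μ_k(A)μ_k(Aᶜ) > 0`,
  sector-preserving maps, `m ≥ 1`: **`Gap(P) ≤ t·Σ_{r∋k}(1 − TV_r)/(2m·μ_k(A)μ_k(Aᶜ))`**.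
* **`hubEdge_acceptance_two_sided`** — on a hub entry `(0, k+1)` with map `φ`, transported domination
  `p·μ_{k+1}(φu) ≤ μ_0(u)`: **`p ≤ α ≤ 1 − ½Σ_u|μ_0(u) − μ_{k+1}(φu)|`** — the one-sided domination constant never
  exceeds one minus the transport defect.

Reading (no numerics implied): a replica whose every partner map misses it by total variation `≥ δ` relaxes no faster
than `t·deg(k)·(1−δ)/(2m·Var_k)`, whatever the rest of the scheme does; and wherever a hub map has defect `δ`, no
domination constant better than `1 − δ` is available to the floor theorems.  NOT CLAIMED: a floor from small defects
alone (the floors need pointwise domination, `Scaling/OneSidedHubFloor`); continuous spaces; anything measured.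
Literature grade (cell rule): OWN COMPOSITION (K9 + F6); nothing cited as a fact; no new bib keys.
-/

noncomputable section

open Finset Function
open Literature.Probability.MarkovChains

namespace Summit.Ventures.LatticeQCDFlow.Scaling

variable {S : Type*} [Fintype S] [DecidableEq S] {K m : ℕ} {μ : Fin (K + 1) → S → ℝ}
  {M : Fin (K + 1) → S → S → ℝ} {w : Fin (K + 1) → ℝ} {t : ℝ} {e : Fin m → Fin (K + 1) × Fin (K + 1)}
  {φ : Fin m → Equiv.Perm S}

/-- **`α_r ≤ 1 − TV_r`:** the stationary acceptance of an entry `(i,l)` with map `ψ` is at most one minus the total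
variation between `μ_i` and the pull-back `μ_l∘ψ` (`i ≠ l`). [ours] -/
theorem edgeAcceptance_le_one_sub_tv (hμ : ∀ k u, 0 < μ k u) (hμ1 : ∀ k, ∑ u, μ k u = 1) (ψ : Equiv.Perm S)
    {i l : Fin (K + 1)} (hil : i ≠ l) :
    ∑ x : Fin (K + 1) → S, min (tensorFun μ x) (tensorFun μ (edgeFlowSwap ψ i l x))
      ≤ 1 - (1 / 2) * ∑ u, |μ i u - μ l (ψ u)| := by
  rw [edgeAcceptance_eq_twoLevel hμ hμ1 ψ hil]
  exact flowPair_acceptance_le_one_sub_tv (hμ1 i) (hμ1 l) ψ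

/-- **THE TRANSPORT DEFECTS AT A REPLICA CAP ITS RATE:** replica `k` idle (`w_k·Q_k(A,Aᶜ) = 0`), `μ_k(A)μ_k(Aᶜ) > 0`,
sector-preserving maps, `m ≥ 1`, `0 ≤ t ≤ 1`, `|S| ≥ 2`:
**`Gap(P) ≤ t·Σ_{r∋k}(1 − ½Σ_u|μ_{i_r}(u) − μ_{l_r}(φ_r u)|)/(2m·μ_k(A)μ_k(Aᶜ))`**. [ours] -/
theorem transportDefect_spectralGap_le [Nontrivial S] (hm : 1 ≤ m) (he : ∀ r, (e r).1 ≠ (e r).2)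
    (hμ : ∀ k x, 0 < μ k x) (hμ1 : ∀ k, ∑ u, μ k u = 1) (hM : ∀ k, IsRowStochastic (M k))
    (hMrev : ∀ k, DetailedBalance (μ k) (M k)) (hw0 : ∀ k, 0 ≤ w k) (hw1 : ∑ k, w k = 1) (ht0 : 0 ≤ t)
    (ht1 : t ≤ 1) {A : Finset S} (hφA : ∀ r u, φ r u ∈ A ↔ u ∈ A) (k : Fin (K + 1))
    (hAk : 0 < (∑ u ∈ A, μ k u) * ∑ u ∈ Aᶜ, μ k u) (hidle : w k * edgeMeasure (μ k) (M k) A Aᶜ = 0) :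
    spectralGap (tensorFun μ) (fun x y : Fin (K + 1) → S => t * ptGraphSwap μ e φ x y + (1 - t) * prodKernel w M x y)
      ≤ t * (∑ r ∈ univ.filter (fun r : Fin m => (e r).1 = k ∨ (e r).2 = k),
              (1 - (1 / 2) * ∑ u, |μ (e r).1 u - μ (e r).2 (φ r u)|))
          / (2 * m * ((∑ u ∈ A, μ k u) * ∑ u ∈ Aᶜ, μ k u)) := by
  have hmpos : (0 : ℝ) < m := Nat.cast_pos.mpr (by omega)
  refine (acceptance_spectralGap_le hm he hμ hμ1 hM hMrev hw0 hw1 ht0 ht1 hφA k hAk hidle).trans ?_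
  refine div_le_div_of_nonneg_right (mul_le_mul_of_nonneg_left (sum_le_sum fun r _ => ?_) ht0) (by positivity)
  exact edgeAcceptance_le_one_sub_tv hμ hμ1 (φ r) (he r)

/-- **ON A HUB ENTRY THE ACCEPTANCE IS PINNED BETWEEN THE DOMINATION CONSTANT AND THE TRANSPORT DEFECT:** for the entry
`(0, k+1)` with map `ψ` and transported domination `p·μ_{k+1}(ψu) ≤ μ_0(u)`:
**`p ≤ α ≤ 1 − ½Σ_u|μ_0(u) − μ_{k+1}(ψu)|`**. [ours] -/
theorem hubEdge_acceptance_two_sided (hμ : ∀ k u, 0 < μ k u) (hμ1 : ∀ k, ∑ u, μ k u = 1) (ψ : Equiv.Perm S)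
    (k : Fin K) {p : ℝ} (hdom : ∀ u, p * μ k.succ (ψ u) ≤ μ 0 u) :
    p ≤ ∑ x : Fin (K + 1) → S, min (tensorFun μ x) (tensorFun μ (edgeFlowSwap ψ 0 k.succ x))
      ∧ ∑ x : Fin (K + 1) → S, min (tensorFun μ x) (tensorFun μ (edgeFlowSwap ψ 0 k.succ x))
          ≤ 1 - (1 / 2) * ∑ u, |μ 0 u - μ k.succ (ψ u)| :=
  ⟨hubEdge_acceptance_ge hμ hμ1 ψ k hdom, edgeAcceptance_le_one_sub_tv hμ hμ1 ψ (Fin.succ_ne_zero k).symm⟩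

/-- **COROLLARY: the domination constant of a hub map never exceeds one minus its transport defect.** [ours] -/
theorem domination_le_one_sub_tv (hμ : ∀ k u, 0 < μ k u) (hμ1 : ∀ k, ∑ u, μ k u = 1) (ψ : Equiv.Perm S)
    (k : Fin K) {p : ℝ} (hdom : ∀ u, p * μ k.succ (ψ u) ≤ μ 0 u) :
    p ≤ 1 - (1 / 2) * ∑ u, |μ 0 u - μ k.succ (ψ u)| :=
  (hubEdge_acceptance_two_sided hμ hμ1 ψ k hdom).1.trans (hubEdge_acceptance_two_sided hμ hμ1 ψ k hdom).2

end Summit.Ventures.LatticeQCDFlow.Scaling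

end
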